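import Literature.Analysis.FluidPDE.Tao2016AveragedNS.SplitCascadeZeroScaleTauOne
import Literature.Analysis.FluidPDE.TaoCascadeZeroScaleEquipartition
import Literature.Analysis.FluidPDE.TaoCascadeZeroScaleFence
import HarnessLib

/-!
# The split Prop. 6.5, §6.7: Prop. 6.17 — the fence `a₁ ≥ 1/20` on the rotor phase ((6.180)–(6.183)) (port of `TaoCascadeZeroScaleFence`)

T. Tao, *Finite time blowup for an averaged three-dimensional Navier–Stokes equation*,
J. Amer. Math. Soc. 29 (2016), 601–674 = arXiv:1402.0290v3, §6.7 (Prop. 6.17 and its proof).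
HONEST FRAMING: statements about the SPLIT cascade model system; nothing here proves the split
Prop. 6.5 and nothing here concerns the true Navier–Stokes equations.

Split counterpart of `TaoCascadeZeroScaleFence.lean` over the split `Setting`
(`SplitCascadeZeroScaleCritical.lean`): theorems that (transitively) read a mode equation take the
window certificate `hw : AsymWindow ε₀ K ε C₁ n₀ W T ζ` (`SplitCascadeRescaledWindow.lean`), with
which every estimate keeps the tree's exact right-hand side; the `Y/F`-only definitions and the
hypothesis-free lemmas of the tree file are reused (`open TaoCascade.ZeroScale`); statements and
proofs are otherwise the tree's, by renaming.

## References

* T. Tao, J. Amer. Math. Soc. 29 (2016), 601–674 = arXiv:1402.0290v3, §6.7.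
  [`Tao2016AveragedNS`]
-/

noncomputable section

open Set MeasureTheory intervalIntegral Filter Topology

namespace Literature.Analysis.FluidPDE

namespace Tao2016AveragedNS

open TaoCascade hiding ExitTrichotomy
open TaoCascade.ZeroScale hiding Context Setting

namespace ZeroScale

open Literature.Analysis.ODE

section Fence

variable {ε₀ K ε C₁ C₂ C₃ C₄ C₅ : ℝ} {n₀ N : ℤ} {ηp : ℤ → ℝ} {βp : ℕ → ℝ} {τ : ℤ → ℝ} {Y : Fin 4 → ℤ → ℝ → ℝ} {W : Fin 3 → ℤ → ℝ → ℝ}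
  {F : ℤ → ℝ → ℝ} {T ζ : ℝ}

/-! ## The error levels of the `a₁`-equation (6.133)/(6.186) -/

/-- The rate `ν = 16 C₄ ε²` of (6.133) is at most `K⁻²⁰`. [cite: Tao2016AveragedNS, §6.7 (6.186)] -/
theorem Setting.nu_le (hs : Setting ε₀ K ε C₁ C₂ C₃ C₄ C₅ n₀ N ηp βp τ Y W F T ζ) :
    16 * C₄ * ε ^ 2 ≤ (K ^ 20)⁻¹ := by
  have hK := hs.K_pos
  have hε := hs.ε_pos
  have hεK := hs.ε_le_K100
  have hC₄ := hs.C₄_le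
  have hC₄0 := hs.C₄_nn
  have h1 : ε ^ 2 ≤ (K ^ 100)⁻¹ * (K ^ 100)⁻¹ := by
    rw [pow_two]; exact mul_le_mul hεK hεK hε.le (by positivity)
  calc 16 * C₄ * ε ^ 2 ≤ 16 * K * ((K ^ 100)⁻¹ * (K ^ 100)⁻¹) := by gcongr
    _ = 16 * (K ^ 179)⁻¹ * (K ^ 20)⁻¹ := by field_simp
    _ ≤ 1 * (K ^ 20)⁻¹ := by
        apply mul_le_mul_of_nonneg_right _ (by positivity)
        have h179 : (K ^ 179)⁻¹ ≤ 1 / 10 ^ 6 * (K ^ 178)⁻¹ := hs.inv_pow_succ_le 178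
        have h178 : (K ^ 178)⁻¹ ≤ 1 := by
          have := hs.inv_pow_anti (n := 0) (m := 178) (by norm_num); simpa using this
        linarith
    _ = (K ^ 20)⁻¹ := one_mul _

/-- The constant error `η₃ = 4C₄e^{-K¹⁰/2}K⁻¹⁰ + 4C₁(1+ε₀)^{-n₀/2}` of (6.133) is at most `K⁻²⁰`.
[cite: Tao2016AveragedNS, §6.7 (6.186)] -/
theorem Setting.eta3_le (hs : Setting ε₀ K ε C₁ C₂ C₃ C₄ C₅ n₀ N ηp βp τ Y W F T ζ) :
    4 * C₄ * Real.exp (-K ^ 10 / 2) * (K ^ 10)⁻¹ + 4 * C₁ * (1 + ε₀) ^ (-(n₀ : ℝ) / 2) ≤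
      (K ^ 20)⁻¹ := by
  have hK := hs.K_pos
  have hε := hs.ε_pos
  have hε1 := hs.ε_le_one hε
  have hC₄ := hs.C₄_le
  have hC₄0 := hs.C₄_nn
  have hexp := hs.exp_half_le
  have hρ : C₁ * (1 + ε₀) ^ (-(n₀ : ℝ) / 2) ≤ (K ^ 100)⁻¹ := by
    have h := hs.ρ_le_ε
    exact h.trans hs.ε_le_K100
  have h1 : 4 * C₄ * Real.exp (-K ^ 10 / 2) * (K ^ 10)⁻¹ ≤ 4 * (K ^ 109)⁻¹ := by
    calc 4 * C₄ * Real.exp (-K ^ 10 / 2) * (K ^ 10)⁻¹ ≤ 4 * K * (K ^ 100)⁻¹ * (K ^ 10)⁻¹ := by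
          gcongr
      _ = 4 * (K ^ 109)⁻¹ := by field_simp
  have h109 : (K ^ 109)⁻¹ ≤ (K ^ 100)⁻¹ := hs.inv_pow_anti (by norm_num)
  have h100 : (K ^ 100)⁻¹ ≤ 1 / 10 ^ 6 * (K ^ 20)⁻¹ :=
    (hs.inv_pow_anti (by norm_num : 21 ≤ 100)).trans (hs.inv_pow_succ_le 20)
  have hK20 : 0 ≤ (K ^ 20)⁻¹ := by positivity
  linarith

/-- **(6.186): `∂ₜa₁ ≥ -16C₄ε²|a₁| - η₃` on `[0, T]`** (from (6.133), dropping the nonnegative term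
`(1+ε₀)^{5/2}K d₀²`). [cite: Tao2016AveragedNS, §6.7 (6.186)] -/
theorem Setting.da_one_ge (hs : Setting ε₀ K ε C₁ C₂ C₃ C₄ C₅ n₀ N ηp βp τ Y W F T ζ) {t : ℝ}
    (ht : t ∈ Icc 0 T) :
    -(16 * C₄ * ε ^ 2) * |Y 0 1 t| -
        (4 * C₄ * Real.exp (-K ^ 10 / 2) * (K ^ 10)⁻¹ + 4 * C₁ * (1 + ε₀) ^ (-(n₀ : ℝ) / 2)) ≤
      dY (τ (n₀ - N)) Y 0 1 t := by
  have h := hs.da_one ht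
  rw [abs_le] at h
  have hpos : 0 ≤ (1 + ε₀) ^ ((5 : ℝ) / 2) * K * Y 3 0 t ^ 2 := by
    have := Real.rpow_nonneg hs.q_pos.le ((5 : ℝ) / 2)
    have := hs.K_pos
    positivity
  linarith [h.1]

/-- `∂ₜa₁ ≥ -3K⁻²⁰` on `[0, T]` (as `|a₁| ≤ 3/2`). [cite: Tao2016AveragedNS, §6.7 (6.186)] -/
theorem Setting.da_one_ge_const (hs : Setting ε₀ K ε C₁ C₂ C₃ C₄ C₅ n₀ N ηp βp τ Y W F T ζ) {t : ℝ}
    (ht : t ∈ Icc 0 T) : -(3 * (K ^ 20)⁻¹) ≤ dY (τ (n₀ - N)) Y 0 1 t := by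
  have h := hs.da_one_ge ht
  have hν := hs.nu_le
  have hη := hs.eta3_le
  have ha := hs.abs_Y_one_le 0 ht
  have hν0 : 0 ≤ 16 * C₄ * ε ^ 2 := by have := hs.C₄_nn; positivity
  have hK20 : 0 ≤ (K ^ 20)⁻¹ := by have := hs.K_pos; positivity
  have : 16 * C₄ * ε ^ 2 * |Y 0 1 t| ≤ (K ^ 20)⁻¹ * (3 / 2) :=
    mul_le_mul hν ha (abs_nonneg _) hK20
  linarith

/-- `a₁(t_c) ≥ -700 K⁻¹⁰` (from (6.155) at `t_c`). [cite: Tao2016AveragedNS, §6.7 (6.155)] -/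
theorem Setting.a_one_tc_ge (hs : Setting ε₀ K ε C₁ C₂ C₃ C₄ C₅ n₀ N ηp βp τ Y W F T ζ) :
    -(700 * (K ^ 10)⁻¹) ≤ Y 0 1 (tc K ε Y T) := by
  have htc := hs.tc_mem
  have hP : ∀ s ∈ Icc 0 (tc K ε Y T), SmallC K ε Y s := fun s hs' => hs.smallC_of_mem_tc hs'
  have h := hs.sqrt_da_le htc hP ⟨htc.1, le_rfl⟩
  have h1 : |Y 0 1 (tc K ε Y T)| ≤ Real.sqrt (Y 3 0 (tc K ε Y T) ^ 2 + Y 0 1 (tc K ε Y T) ^ 2) :=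
    Real.abs_le_sqrt (by nlinarith [sq_nonneg (Y 3 0 (tc K ε Y T))])
  have := neg_abs_le (Y 0 1 (tc K ε Y T))
  linarith

/-- **`a₁ ≥ -K⁻⁹` on the rotor phase `[t_c, τ₁]`** (from `a₁(t_c) ≥ -700K⁻¹⁰` and
`∂ₜa₁ ≥ -3K⁻²⁰`). [cite: Tao2016AveragedNS, §6.7 (6.155), (6.186)] -/
theorem Setting.a_one_ge_rotor (hs : Setting ε₀ K ε C₁ C₂ C₃ C₄ C₅ n₀ N ηp βp τ Y W F T ζ)
    (hex : ExitTrichotomy ε₀ K Y F T) {t : ℝ} (ht : t ∈ Icc (tc K ε Y T) (τone K ε Y T)) :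
    -(K ^ 9)⁻¹ ≤ Y 0 1 t := by
  obtain ⟨htT, ht3, -⟩ := hs.mem_rotor hex ht
  have hK := hs.K_pos
  have htc := hs.tc_mem
  have hτ₀ := hs.τ₀_le
  have hτtc : τ (n₀ - N) ≤ tc K ε Y T := hτ₀.trans htc.1
  have h0 := hs.a_one_tc_ge
  have hbound : ∀ x ∈ Ico (tc K ε Y T) t, -(3 * (K ^ 20)⁻¹) ≤ dY (τ (n₀ - N)) Y 0 1 x :=
    fun x hx => hs.da_one_ge_const ⟨htc.1.trans hx.1, hx.2.le.trans htT.2⟩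
  have h := add_mul_le_of_le_deriv (hs.continuousOn_Y 0 1 (a := tc K ε Y T) (b := t) hτtc)
    (fun x hx => hs.hasDerivWithinAt_Y 0 1 (hτtc.trans hx.1)) hbound ⟨ht.1, le_rfl⟩
  have hlen : t - tc K ε Y T ≤ 3 := by linarith [htc.1]
  have hlen0 : 0 ≤ t - tc K ε Y T := by linarith [ht.1]
  have h10 : (K ^ 10)⁻¹ ≤ 1 / 10 ^ 6 * (K ^ 9)⁻¹ := hs.inv_pow_succ_le 9
  have h20 : (K ^ 20)⁻¹ ≤ 1 / 10 ^ 6 * (K ^ 9)⁻¹ :=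
    (hs.inv_pow_anti (by norm_num : 10 ≤ 20)).trans h10
  have hK9 : 0 < (K ^ 9)⁻¹ := by positivity
  have hK20 : 0 ≤ (K ^ 20)⁻¹ := by positivity
  have : 3 * (K ^ 20)⁻¹ * (t - tc K ε Y T) ≤ 3 * (K ^ 20)⁻¹ * 3 := by gcongr
  nlinarith

/-- `|a₁| ≤ 3/2`, `|a₀| ≤ 3/2`, `|d₀| ≤ 3/2` on the rotor phase (crude energy bounds).
[cite: Tao2016AveragedNS, §6.7 (6.145)] -/
theorem Setting.abs_modes_rotor (hs : Setting ε₀ K ε C₁ C₂ C₃ C₄ C₅ n₀ N ηp βp τ Y W F T ζ)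
    (hex : ExitTrichotomy ε₀ K Y F T) {t : ℝ} (ht : t ∈ Icc (tc K ε Y T) (τone K ε Y T)) :
    |Y 0 0 t| ≤ 3 / 2 ∧ |Y 3 0 t| ≤ 3 / 2 ∧ |Y 0 1 t| ≤ 3 / 2 := by
  obtain ⟨htT, -, -⟩ := hs.mem_rotor hex ht
  exact ⟨hs.abs_Y_zero_le 0 htT, hs.abs_Y_zero_le 3 htT, hs.abs_Y_one_le 0 htT⟩


/-! ## The window `[t_c + K⁻⁹, t_c + 1/K]` -/

/-- `K⁻⁹ ≤ K⁻¹ ≤ 10⁻⁶`, so `t_c ≤ t_c + K⁻⁹ ≤ t_c + 1/K`. [cite: Tao2016AveragedNS, §6.7] -/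
theorem Setting.inv_K_bounds (hs : Setting ε₀ K ε C₁ C₂ C₃ C₄ C₅ n₀ N ηp βp τ Y W F T ζ) :
    0 < (K ^ 9)⁻¹ ∧ (K ^ 9)⁻¹ ≤ K⁻¹ ∧ K⁻¹ ≤ 1 / 10 ^ 6 ∧ 0 < K⁻¹ := by
  have hK := hs.K_pos
  have h1 : (K ^ 9)⁻¹ ≤ (K ^ 1)⁻¹ := hs.inv_pow_anti (by norm_num)
  rw [pow_one] at h1
  refine ⟨by positivity, h1, ?_, inv_pos.2 hK⟩
  rw [one_div]; exact inv_anti₀ (by norm_num) hs.K_large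

/-- Times of the window `[t_c + K⁻⁹, t_c + 1/K]` are in `I = [t_c + K⁻⁹, τ₁]` and in the rotor
phase, once `t_c + 1/K ≤ τ₁`. [cite: Tao2016AveragedNS, §6.7 (6.187)] -/
theorem Setting.mem_window (hs : Setting ε₀ K ε C₁ C₂ C₃ C₄ C₅ n₀ N ηp βp τ Y W F T ζ)
    (hI : tc K ε Y T + K⁻¹ ≤ τone K ε Y T) {t : ℝ}
    (ht : t ∈ Icc (tc K ε Y T + (K ^ 9)⁻¹) (tc K ε Y T + K⁻¹)) :
    t ∈ Icc (tc K ε Y T + (K ^ 9)⁻¹) (τone K ε Y T) ∧ t ∈ Icc (tc K ε Y T) (τone K ε Y T) := by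
  obtain ⟨h9, -, -, -⟩ := hs.inv_K_bounds
  exact ⟨⟨ht.1, ht.2.trans hI⟩, ⟨by linarith [ht.1], ht.2.trans hI⟩⟩

/-- **The backwards fence**: if `a₁(t_c + 1/K) < 0.1` then `a₁ ≤ 0.1001` on the window
`[t_c + K⁻⁹, t_c + 1/K]` ("for `t ∈ [t_c + K⁻⁹, t_c + 1/K]` one has `a₁(t) ≤ 0.1 + O(K⁻²⁰)` by
(6.186), the failure of (6.187), and Gronwall's inequality").
[cite: Tao2016AveragedNS, §6.7 (proof of (6.187))] -/
theorem Setting.a_one_le_of_end_lt (hs : Setting ε₀ K ε C₁ C₂ C₃ C₄ C₅ n₀ N ηp βp τ Y W F T ζ)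
    (hex : ExitTrichotomy ε₀ K Y F T) (hI : tc K ε Y T + K⁻¹ ≤ τone K ε Y T)
    (hv : Y 0 1 (tc K ε Y T + K⁻¹) < 1 / 10) {t : ℝ}
    (ht : t ∈ Icc (tc K ε Y T + (K ^ 9)⁻¹) (tc K ε Y T + K⁻¹)) :
    Y 0 1 t ≤ 1 / 10 + 1 / 10 ^ 4 := by
  by_contra hlt
  push Not at hlt
  obtain ⟨h9, h91, hK1, hK0⟩ := hs.inv_K_bounds
  have hK := hs.K_pos
  have htc := hs.tc_mem
  have hτ₀ := hs.τ₀_le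
  obtain ⟨-, hτT, -, -⟩ := hs.τone_bounds hex
  set v := tc K ε Y T + K⁻¹ with hvdef
  have hτt : τ (n₀ - N) ≤ t := by linarith [ht.1, htc.1, h9]
  set ν := 16 * C₄ * ε ^ 2 with hνdef
  set η := 4 * C₄ * Real.exp (-K ^ 10 / 2) * (K ^ 10)⁻¹ + 4 * C₁ * (1 + ε₀) ^ (-(n₀ : ℝ) / 2)
    with hηdef
  have hν0 : 0 ≤ ν := by have := hs.C₄_nn; positivity
  have hη0 : 0 ≤ η := by
    have := hs.C₄_nn; have := hs.C₁_nn
    have := Real.rpow_nonneg hs.q_pos.le (-(n₀ : ℝ) / 2)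
    positivity
  have hνle : ν ≤ (K ^ 20)⁻¹ := hs.nu_le
  have hηle : η ≤ (K ^ 20)⁻¹ := hs.eta3_le
  have hK20 : (K ^ 20)⁻¹ ≤ 1 / 10 ^ 6 := by
    have h := hs.inv_pow_succ_le 19
    have h19 : (K ^ 19)⁻¹ ≤ 1 := by
      have := hs.inv_pow_anti (n := 0) (m := 19) (by norm_num); simpa using this
    linarith
  have hbound : ∀ s ∈ Ico t v, -ν * |Y 0 1 s| - η ≤ dY (τ (n₀ - N)) Y 0 1 s := by
    intro s hs'
    have hsT : s ∈ Icc 0 T :=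
      ⟨by linarith [hs'.1, ht.1, htc.1, h9.le], by linarith [hs'.2, hI, hτT]⟩
    have := hs.da_one_ge hsT
    simp only [hνdef, hηdef]
    linarith
  have hlen : v - t ≤ 1 := by
    have : v - t ≤ K⁻¹ := by linarith [ht.1, h9.le]
    linarith
  have hlen0 : 0 ≤ v - t := by linarith [ht.2]
  -- the exponential factor is at most `3`
  have hexp : Real.exp (ν * (v - t)) ≤ 3 := by
    have h1 : ν * (v - t) ≤ 1 := by
      calc ν * (v - t) ≤ (K ^ 20)⁻¹ * 1 := by gcongr
        _ ≤ 1 := by linarith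
    calc Real.exp (ν * (v - t)) ≤ Real.exp 1 := Real.exp_le_exp.2 h1
      _ ≤ 3 := exp_one_le_three
  have hφ₀ : η * Real.exp (ν * (v - t)) * (v - t) < 1 / 10 + 1 / 10 ^ 4 := by
    have : η * Real.exp (ν * (v - t)) * (v - t) ≤ (K ^ 20)⁻¹ * 3 * 1 := by
      gcongr
    linarith
  have key := lower_fence_of_abs_rate' (hs.continuousOn_Y 0 1 (a := t) (b := v) hτt)
    (fun x hx => hs.hasDerivWithinAt_Y 0 1 (hτt.trans hx.1)) hν0 hη0 hbound hlt.le hφ₀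
    ⟨ht.2, le_rfl⟩
  -- evaluate the fence at `v`
  have hE : 1 - ν * (v - t) ≤ Real.exp (-ν * (v - t)) := by
    have := Real.add_one_le_exp (-ν * (v - t)); linarith
  have hA : 1 / 10 + 1 / 10 ^ 4 - (K ^ 20)⁻¹ * 3 ≤
      1 / 10 + 1 / 10 ^ 4 - η * Real.exp (ν * (v - t)) * (v - t) := by
    have : η * Real.exp (ν * (v - t)) * (v - t) ≤ (K ^ 20)⁻¹ * 3 * 1 := by gcongr
    linarith
  have hA0 : 0 ≤ 1 / 10 + 1 / 10 ^ 4 - (K ^ 20)⁻¹ * 3 := by linarith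
  have hB : 1 - (K ^ 20)⁻¹ ≤ 1 - ν * (v - t) := by
    have : ν * (v - t) ≤ (K ^ 20)⁻¹ * 1 := by gcongr
    linarith
  have hB0 : 0 ≤ 1 - (K ^ 20)⁻¹ := by linarith
  have hprod : (1 / 10 + 1 / 10 ^ 4 - (K ^ 20)⁻¹ * 3) * (1 - (K ^ 20)⁻¹) ≤
      (1 / 10 + 1 / 10 ^ 4 - η * Real.exp (ν * (v - t)) * (v - t)) * Real.exp (-ν * (v - t)) :=
    mul_le_mul hA (hB.trans hE) hB0 (hA0.trans hA)
  have hK20' : 0 ≤ (K ^ 20)⁻¹ := by positivity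
  nlinarith

/-- **`|a₁| ≤ 0.1001` on the window** if `a₁(t_c + 1/K) < 0.1` (with `a₁ ≥ -K⁻⁹`).
[cite: Tao2016AveragedNS, §6.7 (proof of (6.187))] -/
theorem Setting.abs_a_one_le_of_end_lt (hs : Setting ε₀ K ε C₁ C₂ C₃ C₄ C₅ n₀ N ηp βp τ Y W F T ζ)
    (hex : ExitTrichotomy ε₀ K Y F T) (hI : tc K ε Y T + K⁻¹ ≤ τone K ε Y T)
    (hv : Y 0 1 (tc K ε Y T + K⁻¹) < 1 / 10) {t : ℝ}
    (ht : t ∈ Icc (tc K ε Y T + (K ^ 9)⁻¹) (tc K ε Y T + K⁻¹)) :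
    |Y 0 1 t| ≤ 1 / 10 + 1 / 10 ^ 4 := by
  have h1 := hs.a_one_le_of_end_lt hex hI hv ht
  have h2 := hs.a_one_ge_rotor hex (hs.mem_window hI ht).2
  obtain ⟨h9, h91, hK1, -⟩ := hs.inv_K_bounds
  rw [abs_le]
  constructor <;> linarith

/-- **`∫ d₀²` over the window is small if `a₁(t_c + 1/K) < 0.1`**: from (6.133),
`(1+ε₀)^{5/2}K d₀² ≤ ∂ₜa₁ + 16C₄ε²|a₁| + η₃`, so
`∫_{t_c+K⁻⁹}^{t_c+1/K} d₀² ≤ K⁻¹(a₁(t_c+1/K) - a₁(t_c+K⁻⁹) + 3K⁻²⁰) ≤ K⁻¹(0.1 + 2K⁻⁹)` (the source's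
"`∫ d₀² ≤ 1/(10K) + O(K⁻²)`"). [cite: Tao2016AveragedNS, §6.7 (display before (6.189))] -/
theorem Setting.integral_d_sq_le (hs : Setting ε₀ K ε C₁ C₂ C₃ C₄ C₅ n₀ N ηp βp τ Y W F T ζ)
    (hex : ExitTrichotomy ε₀ K Y F T) (hI : tc K ε Y T + K⁻¹ ≤ τone K ε Y T)
    (hv : Y 0 1 (tc K ε Y T + K⁻¹) < 1 / 10) :
    ∫ s in (tc K ε Y T + (K ^ 9)⁻¹)..(tc K ε Y T + K⁻¹), Y 3 0 s ^ 2 ≤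
      K⁻¹ * (1 / 10 + 2 * (K ^ 9)⁻¹) := by
  obtain ⟨h9, h91, hK1, hK0⟩ := hs.inv_K_bounds
  have hK := hs.K_pos
  have htc := hs.tc_mem
  have hτ₀ := hs.τ₀_le
  obtain ⟨-, hτT, -, -⟩ := hs.τone_bounds hex
  set u := tc K ε Y T + (K ^ 9)⁻¹ with hudef
  set v := tc K ε Y T + K⁻¹ with hvdef
  have huv : u ≤ v := by simp only [hudef, hvdef]; linarith
  have hτu : τ (n₀ - N) ≤ u := by simp only [hudef]; linarith [htc.1]
  set κ := (1 + ε₀) ^ ((5 : ℝ) / 2) * K with hκdef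
  have hq := hs.one_le_q52
  have hκK : K ≤ κ := by
    simp only [hκdef]; nlinarith
  have hκ0 : 0 < κ := hK.trans_le hκK
  set m : ℝ := 3 * (K ^ 20)⁻¹ with hmdef
  -- pointwise: `d₀² ≤ κ⁻¹ (a₁' + m)`
  have hpt : ∀ s ∈ Icc u v, Y 3 0 s ^ 2 ≤ κ⁻¹ * (dY (τ (n₀ - N)) Y 0 1 s + m) := by
    intro s hs'
    have hsT : s ∈ Icc 0 T :=
      ⟨by linarith [hs'.1, htc.1, h9.le], by linarith [hs'.2, hI, hτT]⟩
    have h := hs.da_one hsT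
    have hν := hs.nu_le
    have hη := hs.eta3_le
    have ha := hs.abs_Y_one_le 0 hsT
    have hK20 : 0 ≤ (K ^ 20)⁻¹ := by positivity
    have h1 : 16 * C₄ * ε ^ 2 * |Y 0 1 s| ≤ (K ^ 20)⁻¹ * (3 / 2) :=
      mul_le_mul hν ha (abs_nonneg _) hK20
    rw [abs_le] at h
    have h2 : κ * Y 3 0 s ^ 2 ≤ dY (τ (n₀ - N)) Y 0 1 s + m := by
      simp only [hmdef]; linarith [h.2]
    rw [le_inv_mul_iff₀ hκ0]
    exact h2
  have hcY : ContinuousOn (fun s => Y 3 0 s ^ 2) (Icc u v) := (hs.continuousOn_Y 3 0 hτu).pow 2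
  have hcg : ContinuousOn (fun s => κ⁻¹ * (dY (τ (n₀ - N)) Y 0 1 s + m)) (Icc u v) :=
    continuousOn_const.mul ((hs.continuousOn_dY 0 1 hτu).add continuousOn_const)
  have hmono := intervalIntegral.integral_mono_on huv
    (hcY.intervalIntegrable_of_Icc (μ := volume) huv)
    (hcg.intervalIntegrable_of_Icc (μ := volume) huv) hpt
  -- evaluate the right-hand side
  have hFTC : ∫ s in u..v, dY (τ (n₀ - N)) Y 0 1 s = Y 0 1 v - Y 0 1 u :=
    integral_derivWithin_Ici_eq_sub (hs.hyp.contDiffOn_Y 0 1) hτu huv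
  have hdi : IntervalIntegrable (fun s => dY (τ (n₀ - N)) Y 0 1 s) volume u v :=
    (hs.continuousOn_dY 0 1 hτu).intervalIntegrable_of_Icc huv
  have hrhs : ∫ s in u..v, κ⁻¹ * (dY (τ (n₀ - N)) Y 0 1 s + m) =
      κ⁻¹ * (Y 0 1 v - Y 0 1 u + m * (v - u)) := by
    rw [intervalIntegral.integral_const_mul, intervalIntegral.integral_add hdi
      (intervalIntegrable_const (μ := volume)), hFTC, intervalIntegral.integral_const, smul_eq_mul]
    ring
  rw [hrhs] at hmono
  -- bound the bracket
  have hau : -(K ^ 9)⁻¹ ≤ Y 0 1 u := hs.a_one_ge_rotor hex (hs.mem_window hI ⟨le_rfl, huv⟩).2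
  have hlen : v - u ≤ 1 := by simp only [hudef, hvdef]; linarith
  have hK20 : (K ^ 20)⁻¹ ≤ (K ^ 9)⁻¹ := hs.inv_pow_anti (by norm_num)
  have hbr : Y 0 1 v - Y 0 1 u + m * (v - u) ≤ 1 / 10 + 2 * (K ^ 9)⁻¹ := by
    have : m * (v - u) ≤ 3 * (K ^ 20)⁻¹ * 1 := by
      simp only [hmdef]; gcongr
    have h4 : 3 * (K ^ 20)⁻¹ ≤ (K ^ 9)⁻¹ := by
      have h := hs.inv_pow_succ_le 19
      have h19 : (K ^ 19)⁻¹ ≤ (K ^ 9)⁻¹ := hs.inv_pow_anti (by norm_num)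
      linarith
    linarith
  have hbr0 : 0 ≤ 1 / 10 + 2 * (K ^ 9)⁻¹ := by positivity
  calc ∫ s in u..v, Y 3 0 s ^ 2 ≤ κ⁻¹ * (Y 0 1 v - Y 0 1 u + m * (v - u)) := hmono
    _ ≤ κ⁻¹ * (1 / 10 + 2 * (K ^ 9)⁻¹) :=
        mul_le_mul_of_nonneg_left hbr (inv_pos.2 hκ0).le
    _ ≤ K⁻¹ * (1 / 10 + 2 * (K ^ 9)⁻¹) :=
        mul_le_mul_of_nonneg_right (inv_anti₀ hK hκK) hbr0


/-- **(6.189): equipartition over the window** — `|∫_{t_c+K⁻⁹}^{t_c+1/K} (a₀² - d₀²)| ≤ K⁻⁸⁰`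
("by repeating the derivation of (6.184) we have `∂ₜ(a₀d₀ε²/c₀) = -(a₀²-d₀²) + O(K^{-100})` on `I`,
and hence by the fundamental theorem of calculus and (6.165) `∫ (a₀² - d₀²) = O(K^{-100})`"), by the
landed `abs_integral_sq_sub_sq_le` with `ρ c_min = ε⁻² · K¹⁰⁰ε² = K¹⁰⁰`, `L = 5K¹⁰`, `M = 3/2`.
[cite: Tao2016AveragedNS, §6.7 (6.189)] -/
theorem Setting.abs_integral_sq_sub_sq_window (hs : Setting ε₀ K ε C₁ C₂ C₃ C₄ C₅ n₀ N ηp βp τ Y W F T ζ)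
    (hw : AsymWindow ε₀ K ε C₁ n₀ W T ζ)
    (hex : ExitTrichotomy ε₀ K Y F T) (hI : tc K ε Y T + K⁻¹ ≤ τone K ε Y T) :
    |∫ s in (tc K ε Y T + (K ^ 9)⁻¹)..(tc K ε Y T + K⁻¹), (Y 0 0 s ^ 2 - Y 3 0 s ^ 2)| ≤
      (K ^ 80)⁻¹ := by
  obtain ⟨h9, h91, hK1, hK0⟩ := hs.inv_K_bounds
  have hK := hs.K_pos
  have hε := hs.ε_pos
  have htc := hs.tc_mem
  have hτ₀ := hs.τ₀_le
  obtain ⟨-, hτT, -, -⟩ := hs.τone_bounds hex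
  set u := tc K ε Y T + (K ^ 9)⁻¹ with hudef
  set v := tc K ε Y T + K⁻¹ with hvdef
  have huv : u ≤ v := by simp only [hudef, hvdef]; linarith
  have hτu : τ (n₀ - N) ≤ u := by simp only [hudef]; linarith [htc.1]
  have hwin : ∀ w ∈ Icc u v, w ∈ Icc (tc K ε Y T + (K ^ 9)⁻¹) (τone K ε Y T) ∧
      w ∈ Icc (tc K ε Y T) (τone K ε Y T) := fun w hρw => hs.mem_window hI hρw
  have hwT : ∀ w ∈ Icc u v, w ∈ Icc 0 T := fun w hρw => (hs.mem_rotor hex (hwin w hρw).2).1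
  set ρ₁ := C₁ * (1 + ε₀) ^ (-(n₀ : ℝ) / 2) with hρ₁def
  have hρ₁0 : 0 ≤ ρ₁ := mul_nonneg hs.C₁_nn (Real.rpow_nonneg hs.q_pos.le _)
  have hρ₁1 : ρ₁ ≤ 1 := (hs.ρ_le_ε).trans (hs.ε_le_one hε)
  set κ := (1 + ε₀) ^ ((5 : ℝ) / 2) * K with hκdef
  have hκ8 : |κ| ≤ 8 * K := by
    have hq := hs.q52_le
    have hq0 : 0 ≤ (1 + ε₀) ^ ((5 : ℝ) / 2) := Real.rpow_nonneg hs.q_pos.le _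
    rw [abs_of_nonneg (by positivity)]
    simp only [hκdef]; nlinarith
  set η₁ : ℝ := 5 * ε + 2 * K * (2 * (K ^ 10)⁻¹) + ρ₁ with hη₁def
  have hη₁1 : η₁ ≤ 2 := by
    have hεK := hs.ε_le_K100
    have h100 : (K ^ 100)⁻¹ ≤ 1 / 10 ^ 6 := by
      have h := hs.inv_pow_succ_le 99
      have h99 : (K ^ 99)⁻¹ ≤ 1 := by
        have := hs.inv_pow_anti (n := 0) (m := 99) (by norm_num); simpa using this
      linarith
    have h9' : 2 * K * (2 * (K ^ 10)⁻¹) = 4 * (K ^ 9)⁻¹ := by field_simp; norm_num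
    have h91' : (K ^ 9)⁻¹ ≤ 1 / 10 ^ 6 := h91.trans hK1
    simp only [hη₁def]; rw [h9']; linarith
  have h := abs_integral_sq_sub_sq_le (a₀ := Y 0 0) (d₀ := Y 3 0) (c₀ := Y 2 0) (a₁ := Y 0 1)
    (ρ := (ε ^ 2)⁻¹) (κ := κ) (η₁ := η₁) (η₂ := ρ₁) (L := 5 * K ^ 10) (M := 3 / 2)
    (c_min := K ^ 100 * ε ^ 2) (hs.hyp.contDiffOn_Y 0 0) (hs.hyp.contDiffOn_Y 3 0)
    (hs.hyp.contDiffOn_Y 2 0) hτu huv (by positivity) (by positivity)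
    (fun w hρw => (hs.c_zero_large hw) hex (hwin w hρw).1)
    (fun w hρw => ((hs.dc_zero_rotor hw) hex (hwin w hρw).2).2.2)
    (fun w hρw => (hs.abs_modes_rotor hex (hwin w hρw).2).1)
    (fun w hρw => (hs.abs_modes_rotor hex (hwin w hρw).2).2.1)
    (fun w hρw => (hs.abs_modes_rotor hex (hwin w hρw).2).2.2)
    (fun w hρw => by
      have h1 := hs.da_zero (hwT w hρw)
      have hF := hs.F_negOne_le (hwT w hρw)
      have : 2 * K * F (-1) w ≤ 2 * K * (2 * (K ^ 10)⁻¹) := by gcongr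
      exact h1.trans (by simp only [hη₁def]; linarith))
    (fun w hρw => hs.dd_zero (hwT w hρw))
  refine h.trans ?_
  -- the numerics: `(4.5 + (11.25 K¹⁰ + 27 K + 4.5)(v - u)) / K¹⁰⁰ ≤ K⁻⁸⁰`
  have hden : (ε ^ 2)⁻¹ * (K ^ 100 * ε ^ 2) = K ^ 100 := by field_simp
  rw [hden, div_le_iff₀ (by positivity)]
  have hlen : v - u ≤ 1 := by simp only [hudef, hvdef]; linarith
  have hlen0 : 0 ≤ v - u := by linarith
  have hK1' : (1 : ℝ) ≤ K := hs.one_le_K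
  have hK10 : (1 : ℝ) ≤ K ^ 10 := one_le_pow₀ hK1'
  have hKK : K ≤ K ^ 10 := by
    calc K = K ^ 1 := (pow_one K).symm
      _ ≤ K ^ 10 := pow_le_pow_right₀ hK1' (by norm_num)
  have hcoef : (3 / 2 : ℝ) ^ 2 * (5 * K ^ 10) + |κ| * (3 / 2) ^ 3 + (η₁ + ρ₁) * (3 / 2) ≤
      46 * K ^ 10 := by nlinarith
  have hcoef0 : 0 ≤ (3 / 2 : ℝ) ^ 2 * (5 * K ^ 10) + |κ| * (3 / 2) ^ 3 + (η₁ + ρ₁) * (3 / 2) := by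
    have : 0 ≤ η₁ := by simp only [hη₁def]; positivity
    positivity
  have h80 : (K ^ 80)⁻¹ * K ^ 100 = K ^ 20 := by field_simp
  rw [h80]
  have h20 : 51 * K ^ 10 ≤ K ^ 20 := by
    have : (51 : ℝ) ≤ K ^ 10 := by
      have h6 := hs.K_large
      calc (51 : ℝ) ≤ 10 ^ 6 := by norm_num
        _ ≤ K := h6
        _ ≤ K ^ 10 := hKK
    nlinarith
  calc 2 * (3 / 2 : ℝ) ^ 2 +
        ((3 / 2 : ℝ) ^ 2 * (5 * K ^ 10) + |κ| * (3 / 2) ^ 3 + (η₁ + ρ₁) * (3 / 2)) * (v - u)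
      ≤ 2 * (3 / 2 : ℝ) ^ 2 + 46 * K ^ 10 * 1 := by
        have := mul_le_mul hcoef hlen hlen0 (by positivity : (0:ℝ) ≤ 46 * K ^ 10)
        linarith
    _ ≤ 51 * K ^ 10 := by nlinarith
    _ ≤ K ^ 20 := h20

/-- **`a₀² + d₀² ≥ 0.98` on the window if `a₁(t_c + 1/K) < 0.1`** ("from (6.146), (6.185) we
conclude that `a₀² + d₀² ≥ 0.99 + O(K⁻¹)`"): by (6.146), `b₀ ≤ 4ε`, `c₀ ≤ 2K⁻¹⁰ε` and `|a₁| ≤ 0.1001`.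
[cite: Tao2016AveragedNS, §6.7 (proof of (6.187))] -/
theorem Setting.sq_ad_ge_window (hs : Setting ε₀ K ε C₁ C₂ C₃ C₄ C₅ n₀ N ηp βp τ Y W F T ζ)
    (hw : AsymWindow ε₀ K ε C₁ n₀ W T ζ)
    (hex : ExitTrichotomy ε₀ K Y F T) (hI : tc K ε Y T + K⁻¹ ≤ τone K ε Y T)
    (hv : Y 0 1 (tc K ε Y T + K⁻¹) < 1 / 10) {t : ℝ}
    (ht : t ∈ Icc (tc K ε Y T + (K ^ 9)⁻¹) (tc K ε Y T + K⁻¹)) :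
    98 / 100 ≤ Y 0 0 t ^ 2 + Y 3 0 t ^ 2 := by
  have hK := hs.K_pos
  have hε := hs.ε_pos
  obtain ⟨hwI, hwr⟩ := hs.mem_window hI ht
  obtain ⟨htT, -, -⟩ := hs.mem_rotor hex hwr
  have hS := hs.sumSq_bound htT
  have ha1 := hs.abs_a_one_le_of_end_lt hex hI hv ht
  obtain ⟨hblo, hbhi⟩ := (hs.b_zero_rotor hw) hex hwr
  obtain ⟨-, hc⟩ := (hs.c_zero_rotor_upper hw) hex hwr
  obtain ⟨-, hcpos⟩ := (hs.c_zero_rotor_pos hw) hex hwr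
  obtain ⟨-, hε2⟩ := hs.ρ_le_ε4
  -- `b₀² ≤ 16 ε²`
  have hb2 : Y 1 0 t ^ 2 ≤ 16 * ε ^ 2 := by nlinarith
  -- `c₀ ≤ 2K⁻¹⁰ ε ≤ 10⁻³`, so `c₀² ≤ 10⁻⁶`
  have hc1 : Y 2 0 t ≤ 2 * (K ^ 10)⁻¹ * ε := by
    have hhalf := hs.K_rpow_neg_half_le
    have hexp : Real.exp (4 * K ^ 10 * K ^ (-(1 : ℝ) / 2)) ≤ Real.exp (10 ^ 6 * K ^ 10) := by
      apply Real.exp_le_exp.2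
      have hK10 : 0 ≤ K ^ 10 := pow_nonneg hK.le 10
      have : K ^ (-(1 : ℝ) / 2) ≤ 1 := by linarith
      nlinarith [Real.rpow_nonneg hK.le (-(1 : ℝ) / 2)]
    have hεexp := hs.ε_exp
    calc Y 2 0 t ≤ Real.exp (4 * K ^ 10 * K ^ (-(1 : ℝ) / 2)) * (2 * ((K ^ 10)⁻¹ * ε ^ 2)) := hc
      _ ≤ Real.exp (10 ^ 6 * K ^ 10) * (2 * ((K ^ 10)⁻¹ * ε ^ 2)) := by gcongr
      _ = 2 * (K ^ 10)⁻¹ * ε * (ε * Real.exp (10 ^ 6 * K ^ 10)) := by ring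
      _ ≤ 2 * (K ^ 10)⁻¹ * ε * 1 := by gcongr
      _ = _ := mul_one _
  have hc2 : Y 2 0 t ^ 2 ≤ 1 / 10 ^ 6 := by
    have hK10 : (K ^ 10)⁻¹ ≤ 1 / 10 ^ 6 := by
      have h := hs.inv_pow_succ_le 9
      have h9 : (K ^ 9)⁻¹ ≤ 1 := by
        have := hs.inv_pow_anti (n := 0) (m := 9) (by norm_num); simpa using this
      linarith
    have hε1 := hs.ε_le_one hε
    have hc3 : Y 2 0 t ≤ 1 / 10 ^ 3 := by nlinarith
    nlinarith
  -- `a₁² ≤ 0.1001²`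
  have ha2 : Y 0 1 t ^ 2 ≤ (1 / 10 + 1 / 10 ^ 4) ^ 2 := by
    have := pow_le_pow_left₀ (abs_nonneg _) ha1 2
    rwa [sq_abs] at this
  have hK8 : (K ^ 8)⁻¹ ≤ 1 / 10 ^ 6 := by
    have h := hs.inv_pow_succ_le 7
    have h7 : (K ^ 7)⁻¹ ≤ 1 := by
      have := hs.inv_pow_anti (n := 0) (m := 7) (by norm_num); simpa using this
    linarith
  have hK10' : (K ^ 10)⁻¹ ≤ 1 := by
    have := hs.inv_pow_anti (n := 0) (m := 10) (by norm_num); simpa using this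
  rw [abs_le] at hS
  unfold sumSq at hS
  nlinarith

/-- **(6.187): `a₁(t_c + 1/K) ≥ 0.1`** (once `t_c + 1/K ≤ τ₁`). By contradiction: otherwise
`∫ d₀² ≤ (0.1 + 2K⁻⁹)/K` over the window `[t_c + K⁻⁹, t_c + 1/K]` (`integral_d_sq_le`) and
`|∫ (a₀² - d₀²)| ≤ K⁻⁸⁰` (equipartition), so `∫ (a₀² + d₀²) ≤ 0.21/K`, whereas `a₀² + d₀² ≥ 0.98`
pointwise forces `∫ (a₀² + d₀²) ≥ 0.98(1/K - K⁻⁹)` — the source's "which contradicts (6.190)".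
[cite: Tao2016AveragedNS, §6.7 (6.187), (6.189)–(6.190)] -/
theorem Setting.a_one_tenth (hs : Setting ε₀ K ε C₁ C₂ C₃ C₄ C₅ n₀ N ηp βp τ Y W F T ζ)
    (hw : AsymWindow ε₀ K ε C₁ n₀ W T ζ)
    (hex : ExitTrichotomy ε₀ K Y F T) (hI : tc K ε Y T + K⁻¹ ≤ τone K ε Y T) :
    1 / 10 ≤ Y 0 1 (tc K ε Y T + K⁻¹) := by
  by_contra hv
  push Not at hv
  obtain ⟨h9, h91, hK1, hK0⟩ := hs.inv_K_bounds
  have hK := hs.K_pos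
  have htc := hs.tc_mem
  have hτ₀ := hs.τ₀_le
  set u := tc K ε Y T + (K ^ 9)⁻¹ with hudef
  set v := tc K ε Y T + K⁻¹ with hvdef
  have huv : u ≤ v := by simp only [hudef, hvdef]; linarith
  have hτu : τ (n₀ - N) ≤ u := by simp only [hudef]; linarith [htc.1]
  have h1 := hs.integral_d_sq_le hex hI hv
  have h2 := (hs.abs_integral_sq_sub_sq_window hw) hex hI
  have hpt : ∀ s ∈ Icc u v, (98 / 100 : ℝ) ≤ Y 0 0 s ^ 2 + Y 3 0 s ^ 2 := fun s hs' =>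
    (hs.sq_ad_ge_window hw) hex hI hv hs'
  -- integrability
  have hca : ContinuousOn (fun s => Y 0 0 s ^ 2) (Icc u v) := (hs.continuousOn_Y 0 0 hτu).pow 2
  have hcd : ContinuousOn (fun s => Y 3 0 s ^ 2) (Icc u v) := (hs.continuousOn_Y 3 0 hτu).pow 2
  have hia : IntervalIntegrable (fun s => Y 0 0 s ^ 2) volume u v := hca.intervalIntegrable_of_Icc huv
  have hid : IntervalIntegrable (fun s => Y 3 0 s ^ 2) volume u v := hcd.intervalIntegrable_of_Icc huv
  have h3 : ∫ s in u..v, (98 / 100 : ℝ) ≤ ∫ s in u..v, (Y 0 0 s ^ 2 + Y 3 0 s ^ 2) :=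
    intervalIntegral.integral_mono_on huv (intervalIntegrable_const (μ := volume)) (hia.add hid) hpt
  have e1 : ∫ s in u..v, (98 / 100 : ℝ) = 98 / 100 * (v - u) := by
    simp only [intervalIntegral.integral_const, smul_eq_mul]; ring
  have e2 : ∫ s in u..v, (Y 0 0 s ^ 2 + Y 3 0 s ^ 2) =
      (∫ s in u..v, (Y 0 0 s ^ 2 - Y 3 0 s ^ 2)) + 2 * ∫ s in u..v, Y 3 0 s ^ 2 := by
    rw [intervalIntegral.integral_add hia hid, intervalIntegral.integral_sub hia hid]; ring
  rw [e1, e2] at h3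
  have h4 := le_abs_self (∫ s in u..v, (Y 0 0 s ^ 2 - Y 3 0 s ^ 2))
  have hlen : K⁻¹ - (K ^ 9)⁻¹ = v - u := by simp only [hudef, hvdef]; ring
  have h98 : (K ^ 9)⁻¹ ≤ 1 / 10 ^ 6 * K⁻¹ := by
    have h := hs.inv_pow_succ_le 8
    have h8 : (K ^ 8)⁻¹ ≤ (K ^ 1)⁻¹ := hs.inv_pow_anti (by norm_num)
    rw [pow_one] at h8
    linarith
  have h80 : (K ^ 80)⁻¹ ≤ 1 / 10 ^ 6 * K⁻¹ := by
    have h := hs.inv_pow_succ_le 79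
    have h79 : (K ^ 79)⁻¹ ≤ (K ^ 1)⁻¹ := hs.inv_pow_anti (by norm_num)
    rw [pow_one] at h79
    linarith
  rw [← hlen] at h3
  nlinarith

/-- **(6.188): `a₁ ≥ 0.05` on `[t_c + 1/K, τ₁]`** ("then by Gronwall's inequality we will have
`a₁(t) ≥ 0.05` for all `t_c + 1/K ≤ t ≤ τ₁`"), by the fence lemma from `a₁(t_c + 1/K) ≥ 0.1`.
[cite: Tao2016AveragedNS, §6.7 (6.188)] -/
theorem Setting.a_one_ge_twentieth (hs : Setting ε₀ K ε C₁ C₂ C₃ C₄ C₅ n₀ N ηp βp τ Y W F T ζ)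
    (hw : AsymWindow ε₀ K ε C₁ n₀ W T ζ)
    (hex : ExitTrichotomy ε₀ K Y F T) (hI : tc K ε Y T + K⁻¹ ≤ τone K ε Y T) {t : ℝ}
    (ht : t ∈ Icc (tc K ε Y T + K⁻¹) (τone K ε Y T)) : 1 / 20 ≤ Y 0 1 t := by
  obtain ⟨h9, h91, hK1, hK0⟩ := hs.inv_K_bounds
  have hK := hs.K_pos
  have htc := hs.tc_mem
  have hτ₀ := hs.τ₀_le
  obtain ⟨-, hτT, hτK, -⟩ := hs.τone_bounds hex
  have hhalf := hs.K_rpow_neg_half_le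
  set v := tc K ε Y T + K⁻¹ with hvdef
  set b := τone K ε Y T with hbdef
  have hτv : τ (n₀ - N) ≤ v := by simp only [hvdef]; linarith [htc.1]
  have h0 : 1 / 10 ≤ Y 0 1 v := (hs.a_one_tenth hw) hex hI
  set ν := 16 * C₄ * ε ^ 2 with hνdef
  set η := 4 * C₄ * Real.exp (-K ^ 10 / 2) * (K ^ 10)⁻¹ + 4 * C₁ * (1 + ε₀) ^ (-(n₀ : ℝ) / 2)
    with hηdef
  have hν0 : 0 ≤ ν := by have := hs.C₄_nn; positivity
  have hη0 : 0 ≤ η := by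
    have := hs.C₄_nn; have := hs.C₁_nn
    have := Real.rpow_nonneg hs.q_pos.le (-(n₀ : ℝ) / 2)
    positivity
  have hνle : ν ≤ (K ^ 20)⁻¹ := hs.nu_le
  have hηle : η ≤ (K ^ 20)⁻¹ := hs.eta3_le
  have hK20 : (K ^ 20)⁻¹ ≤ 1 / 10 ^ 6 := by
    have h := hs.inv_pow_succ_le 19
    have h19 : (K ^ 19)⁻¹ ≤ 1 := by
      have := hs.inv_pow_anti (n := 0) (m := 19) (by norm_num); simpa using this
    linarith
  have hbound : ∀ s ∈ Ico v b, -ν * |Y 0 1 s| - η ≤ dY (τ (n₀ - N)) Y 0 1 s := by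
    intro s hs'
    have hsT : s ∈ Icc 0 T := ⟨by linarith [hs'.1, htc.1, hK0.le], by linarith [hs'.2, hτT]⟩
    have := hs.da_one_ge hsT
    simp only [hνdef, hηdef]
    linarith
  have hlen : b - v ≤ 1 := by
    have : b - v ≤ K ^ (-(1 : ℝ) / 2) := by simp only [hvdef]; linarith [hK0.le]
    linarith
  have hlen0 : 0 ≤ b - v := by linarith [ht.1, ht.2]
  have hexp : Real.exp (ν * (b - v)) ≤ 3 := by
    have h1 : ν * (b - v) ≤ 1 := by
      calc ν * (b - v) ≤ (K ^ 20)⁻¹ * 1 := by gcongr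
        _ ≤ 1 := by linarith
    calc Real.exp (ν * (b - v)) ≤ Real.exp 1 := Real.exp_le_exp.2 h1
      _ ≤ 3 := exp_one_le_three
  have hφ₀ : η * Real.exp (ν * (b - v)) * (b - v) < 1 / 10 := by
    have : η * Real.exp (ν * (b - v)) * (b - v) ≤ (K ^ 20)⁻¹ * 3 * 1 := by gcongr
    linarith
  have key := lower_fence_of_abs_rate' (hs.continuousOn_Y 0 1 (a := v) (b := b) hτv)
    (fun x hx => hs.hasDerivWithinAt_Y 0 1 (hτv.trans hx.1)) hν0 hη0 hbound h0 hφ₀ ht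
  have htv : t - v ≤ b - v := by linarith [ht.2]
  have htv0 : 0 ≤ t - v := by linarith [ht.1]
  have hE : 1 - ν * (t - v) ≤ Real.exp (-ν * (t - v)) := by
    have := Real.add_one_le_exp (-ν * (t - v)); linarith
  have hA : 1 / 10 - (K ^ 20)⁻¹ * 3 ≤ 1 / 10 - η * Real.exp (ν * (b - v)) * (t - v) := by
    have : η * Real.exp (ν * (b - v)) * (t - v) ≤ (K ^ 20)⁻¹ * 3 * 1 := by
      apply mul_le_mul (mul_le_mul hηle hexp (Real.exp_pos _).le (by positivity))
        (htv.trans hlen) htv0 (by positivity)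
    linarith
  have hA0 : 0 ≤ 1 / 10 - (K ^ 20)⁻¹ * 3 := by linarith
  have hB : 1 - (K ^ 20)⁻¹ ≤ 1 - ν * (t - v) := by
    have : ν * (t - v) ≤ (K ^ 20)⁻¹ * 1 := by
      apply mul_le_mul hνle (htv.trans hlen) htv0 (by positivity)
    linarith
  have hB0 : 0 ≤ 1 - (K ^ 20)⁻¹ := by linarith
  have hprod : (1 / 10 - (K ^ 20)⁻¹ * 3) * (1 - (K ^ 20)⁻¹) ≤
      (1 / 10 - η * Real.exp (ν * (b - v)) * (t - v)) * Real.exp (-ν * (t - v)) :=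
    mul_le_mul hA (hB.trans hE) hB0 (hA0.trans hA)
  have hK20' : 0 ≤ (K ^ 20)⁻¹ := by positivity
  nlinarith

end Fence

end ZeroScale

end Tao2016AveragedNS

end Literature.Analysis.FluidPDE
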